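import Summits.ValiantsHypothesis.ValiantsHypothesis.Theorems.DivisionGapPerDivisionHardStubMagnetRigidAux

/-!
# Crux `DivisionGap.PerDivisionHard` (stmt-ValiantsHypothesis-5065), line `pair-descent-jss-endpoint` —
stub `stub_magnetRigid`, part 3/4: the key claim (lexicographic dominance of the bouncing walk)

Pure combinatorics on `ℕ`-indexed rows `r 0, …, r (L-1)` (`r 0 = R₀`, no two consecutive equal) and columns
`c 0, …, c L` (`c L = c 0`, no two consecutive equal), `L = 2H ≥ 2`, with prices `u` as in `magnet_prices`
(part 2/4) and a steep tower `M1 ≫ M2 ≫ M3, M4 ≫ L`.  With `RowRew = Σ_t u(r t, a₀)`,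
`ColRew = Σ_t u(ρ₀, c (t+1))`, `Cost = Σ_t (u(r t, c t) + 2u(r t, c (t+1)))` and the bouncing walk
`(rA, cA) = (R₀, R₁, R₂, R₁, R₂, …; C_a, C_b, C_a, …)`, `magnet_key` proves: either
`3RowRew + 3ColRew + Cost(A) < 3RowRew(A) + 3ColRew(A) + Cost` (the walk is STRICTLY worse than the
bouncing walk for the objective `3RowRew + 3ColRew − Cost` of (★), part 1/4), or `(r, c) = (rA, cA)`.

Proof (levels; each level's loss beats the total range of the levels below it):
1. `R₁` occupies at most one of each pair `(2j, 2j+1)` of consecutive positions, so `≤ H` positions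
   (`magnet_pair_count`); fewer than `H` loses `≥ 3M1 − O(H·M2)`.
2. With `H` visits, a domino induction from `r 0 = R₀ ≠ R₁` puts `R₁` exactly at the odd positions; then `R₂`
   occupies at most the `H − 1` even positions `≥ 2`; fewer loses `≥ 3M2 − O(H·M3)`; all of them pins `r = rA`.
3. `C_a`, `C_b` each occupy at most one of each pair `(2j+1, 2j+2)` of the positions `1..L`; fewer than `H` of
   `C_a` loses `≥ 3M3 − O(H)`, then fewer than `H` of `C_b` loses `≥ 3M4 − O(H)`.
4. With `H` of each they alternate (`magnet_alt_pattern`); the phase `c 1 = C_a` (so `c 0 = C_b`) has the same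
   rewards and cost `8H > 7H = Cost(A)`; the phase `c 1 = C_b` is `cA`.
-/

noncomputable section

-- `Summit.ValiantsHypothesis.ValiantsHypothesis.…` is the tree's mandated single-conjunct layout
-- (Sub = Summit), so the duplicated namespace component is intended.
set_option linter.dupNamespace false

namespace Summit.ValiantsHypothesis.ValiantsHypothesis.Theorems.DivisionGapPerDivisionHard

open scoped BigOperators

/-! ### The key claim: lexicographic dominance of the bouncing walk -/

/-- **The key claim (pure combinatorics on `ℕ`-indexed rows and columns).**  Rows `r 0, …, r (L-1)` with
`r 0 = R₀` and no two consecutive equal, columns `c 0, …, c L` with `c L = c 0` and no two consecutive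
equal, `L = 2H ≥ 2`; prices as in `magnet_prices` with a sufficiently steep tower `M1 ≫ M2 ≫ M3, M4 ≫ L`.
Writing `RowRew = Σ_t u(r t, a₀)`, `ColRew = Σ_t u(ρ₀, c (t+1))`, `Cost = Σ_t (u(r t, c t) + 2u(r t, c (t+1)))`
and `rA, cA` for the bouncing walk (`rA = R₀, R₁, R₂, R₁, R₂, …`, `cA = C_a, C_b, C_a, …`): either
`3RowRew + 3ColRew + Cost(A) < 3RowRew(A) + 3ColRew(A) + Cost` (STRICTLY worse), or `(r, c) = (rA, cA)`.
Proof: `R₁` occupies at most one of each pair of consecutive positions, so at most `H`, with equality only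
at exactly the odd positions; then `R₂` occupies at most the `H - 1` even positions `≥ 2`; then `C_a` and
`C_b` each occupy at most `H` of the positions `1..L`, with equality only if they alternate; of the two
alternating phases the one with `c 0 = C_b` costs `8H > 7H`.  Each level's loss (`≥ 3M1 - …`, `≥ 3M2 - …`,
`≥ 3M3 - …`, `≥ 3M4 - …`, `H`) beats everything below it. [folklore] -/
theorem magnet_key {α : Type*} [DecidableEq α] (u : α × α → ℕ) (L H : ℕ) (hL : L = 2 * H)
    (hH : 1 ≤ H) (R₀ R₁ R₂ ρ₀ a₀ Ca Cb : α) (M1 M2 M3 M4 : ℕ)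
    (h01 : R₀ ≠ R₁) (h02 : R₀ ≠ R₂) (h12 : R₁ ≠ R₂) (hab : Ca ≠ Cb)
    (hA1 : u (R₁, a₀) = M1) (hA2 : u (R₂, a₀) = M2) (hA0 : ∀ R, R ≠ R₁ → R ≠ R₂ → u (R, a₀) ≤ 1)
    (hP1 : u (ρ₀, Ca) = M3) (hP2 : u (ρ₀, Cb) = M4) (hP0 : ∀ C, C ≠ Ca → C ≠ Cb → u (ρ₀, C) ≤ 1)
    (h0a : u (R₀, Ca) = 1) (h0b : u (R₀, Cb) = 1) (h1a : u (R₁, Ca) = 1) (h1b : u (R₁, Cb) = 2)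
    (h2a : u (R₂, Ca) = 1) (h2b : u (R₂, Cb) = 1)
    (hM1 : 6 * H * M2 + 6 * H * M3 + 6 * H * M4 + 19 * H < 3 * M1)
    (hM2 : 6 * H * M3 + 6 * H * M4 + 19 * H < 3 * M2)
    (hM3 : 13 * H < 3 * M3) (hM4 : 13 * H < 3 * M4)
    (rA cA : ℕ → α) (hrA0 : rA 0 = R₀) (hrA1 : ∀ j, rA (2 * j + 1) = R₁)
    (hrA2 : ∀ j, 1 ≤ j → rA (2 * j) = R₂) (hcA0 : ∀ j, cA (2 * j) = Ca)
    (hcA1 : ∀ j, cA (2 * j + 1) = Cb)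
    (r c : ℕ → α) (hr0 : r 0 = R₀) (hrr : ∀ t, t + 1 < L → r t ≠ r (t + 1))
    (hcc : ∀ s, s < L → c s ≠ c (s + 1)) (hcL : c L = c 0) :
    3 * ∑ t ∈ Finset.range L, u (r t, a₀) + 3 * ∑ t ∈ Finset.range L, u (ρ₀, c (t + 1)) +
        ∑ t ∈ Finset.range L, (u (rA t, cA t) + 2 * u (rA t, cA (t + 1))) <
      3 * ∑ t ∈ Finset.range L, u (rA t, a₀) + 3 * ∑ t ∈ Finset.range L, u (ρ₀, cA (t + 1)) +
        ∑ t ∈ Finset.range L, (u (r t, c t) + 2 * u (r t, c (t + 1))) ∨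
    ((∀ t, t < L → r t = rA t) ∧ (∀ s, s ≤ L → c s = cA s)) := by
  subst hL
  /- 1. The winner's sums. -/
  have hRRa : M1 * H + M2 * H ≤ ∑ t ∈ Finset.range (2 * H), u (rA t, a₀) + M2 := by
    rw [magnet_sum_range_two_mul]
    obtain ⟨H', rfl⟩ : ∃ H', H = H' + 1 := ⟨H - 1, by omega⟩
    rw [Finset.sum_range_succ']
    have h1 : ∀ j ∈ Finset.range H',
        u (rA (2 * (j + 1)), a₀) + u (rA (2 * (j + 1) + 1), a₀) = M2 + M1 := by
      intro j _
      rw [hrA2 (j + 1) (by omega), hrA1, hA1, hA2]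
    rw [Finset.sum_congr rfl h1, Finset.sum_const, Finset.card_range, smul_eq_mul, hrA1, hA1]
    linarith
  have hCRa : ∑ t ∈ Finset.range (2 * H), u (ρ₀, cA (t + 1)) = H * (M4 + M3) := by
    rw [magnet_sum_range_two_mul]
    have h1 : ∀ j ∈ Finset.range H,
        u (ρ₀, cA (2 * j + 1)) + u (ρ₀, cA (2 * j + 1 + 1)) = M4 + M3 := by
      intro j _
      rw [hcA1, show 2 * j + 1 + 1 = 2 * (j + 1) by ring, hcA0, hP2, hP1]
    rw [Finset.sum_congr rfl h1, Finset.sum_const, Finset.card_range, smul_eq_mul]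
  have hKa : ∑ t ∈ Finset.range (2 * H), (u (rA t, cA t) + 2 * u (rA t, cA (t + 1))) = H * 7 := by
    rw [magnet_sum_range_two_mul]
    have h1 : ∀ j ∈ Finset.range H,
        u (rA (2 * j), cA (2 * j)) + 2 * u (rA (2 * j), cA (2 * j + 1)) +
          (u (rA (2 * j + 1), cA (2 * j + 1)) + 2 * u (rA (2 * j + 1), cA (2 * j + 1 + 1))) = 7 := by
      intro j _
      rw [hcA0, hcA1, hrA1, show 2 * j + 1 + 1 = 2 * (j + 1) by ring, hcA0, h1b, h1a]
      rcases Nat.eq_zero_or_pos j with rfl | hj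
      · rw [Nat.mul_zero, hrA0, h0a, h0b]
      · rw [hrA2 j hj, h2a, h2b]
    rw [Finset.sum_congr rfl h1, Finset.sum_const, Finset.card_range, smul_eq_mul]
  /- 2. Crude bounds for an arbitrary walk. -/
  have hcnt_le : ∀ (g : ℕ → α) (a : α),
      ∑ t ∈ Finset.range (2 * H), (if g t = a then 1 else 0) ≤ 2 * H := by
    intro g a
    refine (Finset.sum_le_card_nsmul _ _ 1 fun t _ => ?_).trans (by simp)
    split_ifs <;> omega
  have hRRle : ∑ t ∈ Finset.range (2 * H), u (r t, a₀) ≤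
      M1 * ∑ t ∈ Finset.range (2 * H), (if r t = R₁ then 1 else 0) +
        M2 * ∑ t ∈ Finset.range (2 * H), (if r t = R₂ then 1 else 0) + 2 * H := by
    have hpt : ∀ t ∈ Finset.range (2 * H), u (r t, a₀) ≤
        M1 * (if r t = R₁ then 1 else 0) + M2 * (if r t = R₂ then 1 else 0) + 1 := by
      intro t _
      by_cases h1 : r t = R₁
      · rw [if_pos h1, h1, if_neg h12, hA1]
        omega
      · by_cases h2 : r t = R₂
        · rw [if_neg h1, if_pos h2, h2, hA2]
          omega
        · rw [if_neg h1, if_neg h2]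
          have := hA0 (r t) h1 h2
          omega
    refine (Finset.sum_le_sum hpt).trans (le_of_eq ?_)
    rw [Finset.sum_add_distrib, Finset.sum_add_distrib, ← Finset.mul_sum, ← Finset.mul_sum,
      Finset.sum_const, Finset.card_range, smul_eq_mul, mul_one]
  have hCRle : ∑ t ∈ Finset.range (2 * H), u (ρ₀, c (t + 1)) ≤
      M3 * ∑ t ∈ Finset.range (2 * H), (if c (t + 1) = Ca then 1 else 0) +
        M4 * ∑ t ∈ Finset.range (2 * H), (if c (t + 1) = Cb then 1 else 0) + 2 * H := by
    have hpt : ∀ t ∈ Finset.range (2 * H), u (ρ₀, c (t + 1)) ≤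
        M3 * (if c (t + 1) = Ca then 1 else 0) + M4 * (if c (t + 1) = Cb then 1 else 0) + 1 := by
      intro t _
      by_cases h1 : c (t + 1) = Ca
      · rw [if_pos h1, h1, if_neg hab, hP1]
        omega
      · by_cases h2 : c (t + 1) = Cb
        · rw [if_neg h1, if_pos h2, h2, hP2]
          omega
        · rw [if_neg h1, if_neg h2]
          have := hP0 (c (t + 1)) h1 h2
          omega
    refine (Finset.sum_le_sum hpt).trans (le_of_eq ?_)
    rw [Finset.sum_add_distrib, Finset.sum_add_distrib, ← Finset.mul_sum, ← Finset.mul_sum,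
      Finset.sum_const, Finset.card_range, smul_eq_mul, mul_one]
  have p2 : M2 * ∑ t ∈ Finset.range (2 * H), (if r t = R₂ then 1 else 0) ≤ M2 * (2 * H) :=
    Nat.mul_le_mul_left M2 (hcnt_le r R₂)
  have p3 : M3 * ∑ t ∈ Finset.range (2 * H), (if c (t + 1) = Ca then 1 else 0) ≤ M3 * (2 * H) :=
    Nat.mul_le_mul_left M3 (hcnt_le _ Ca)
  have p4 : M4 * ∑ t ∈ Finset.range (2 * H), (if c (t + 1) = Cb then 1 else 0) ≤ M4 * (2 * H) :=
    Nat.mul_le_mul_left M4 (hcnt_le _ Cb)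
  have p5 : M2 ≤ M2 * H := Nat.le_mul_of_pos_right M2 hH
  have hK0 : 0 ≤ ∑ t ∈ Finset.range (2 * H), (u (r t, c t) + 2 * u (r t, c (t + 1))) :=
    Nat.zero_le _
  have hCRa0 : 0 ≤ ∑ t ∈ Finset.range (2 * H), u (ρ₀, cA (t + 1)) := Nat.zero_le _
  /- 3. Level 1: the visits of `R₁`. -/
  have hsplit1 := magnet_sum_range_two_mul (fun t => if r t = R₁ then 1 else 0) H
  obtain ⟨hN1le, hN1eq⟩ := magnet_pair_count (fun j => r (2 * j)) (fun j => r (2 * j + 1)) R₁ H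
    (fun j hj => hrr (2 * j) (by omega))
  rcases hN1le.lt_or_eq with hlt1 | heq1
  · -- fewer than `H` visits of `R₁`: strictly worse
    left
    have p1 : M1 * ∑ t ∈ Finset.range (2 * H), (if r t = R₁ then 1 else 0) + M1 ≤ M1 * H := by
      rw [hsplit1, ← Nat.mul_succ]
      exact Nat.mul_le_mul_left M1 hlt1
    linarith
  /- 4. Level 2: `R₁` exactly at the odd positions; the visits of `R₂`. -/
  have hpair1 := hN1eq heq1
  have hdom : ∀ j, j < H → r (2 * j) ≠ R₁ ∧ r (2 * j + 1) = R₁ := by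
    intro j
    induction j with
    | zero =>
      intro hj
      have h0 : r (2 * 0) ≠ R₁ := by
        rw [Nat.mul_zero, hr0]
        exact h01
      have hp := hpair1 0 hj
      rw [if_neg h0, zero_add] at hp
      refine ⟨h0, ?_⟩
      by_contra h
      rw [if_neg h] at hp
      omega
    | succ j ih =>
      intro hj
      have h1 := (ih (by omega)).2
      have hne : r (2 * (j + 1)) ≠ R₁ := by
        rw [show 2 * (j + 1) = 2 * j + 1 + 1 by ring]
        exact fun h => hrr (2 * j + 1) (by omega) (h1.trans h.symm)
      have hp := hpair1 (j + 1) hj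
      rw [if_neg hne, zero_add] at hp
      refine ⟨hne, ?_⟩
      by_contra h
      rw [if_neg h] at hp
      omega
  have hsplit2 := magnet_sum_range_two_mul (fun t => if r t = R₂ then 1 else 0) H
  have hodd0 : ∀ j ∈ Finset.range H,
      (if r (2 * j) = R₂ then 1 else 0) + (if r (2 * j + 1) = R₂ then 1 else 0) =
        (if r (2 * j) = R₂ then 1 else 0) := by
    intro j hj
    rw [(hdom j (Finset.mem_range.1 hj)).2, if_neg h12, add_zero]
  rw [Finset.sum_congr rfl hodd0] at hsplit2
  have h0mem : (0 : ℕ) ∈ Finset.range H := Finset.mem_range.2 (by omega)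
  have hz : (if r (2 * 0) = R₂ then 1 else 0) = 0 := by
    rw [Nat.mul_zero, hr0, if_neg h02]
  have hsplit2' : ∑ j ∈ Finset.range H, (if r (2 * j) = R₂ then 1 else 0) =
      ∑ j ∈ (Finset.range H).erase 0, (if r (2 * j) = R₂ then 1 else 0) :=
    (Finset.sum_erase (Finset.range H) (f := fun j => if r (2 * j) = R₂ then 1 else 0) hz).symm
  have hcardE : ((Finset.range H).erase 0).card = H - 1 := by
    rw [Finset.card_erase_of_mem h0mem, Finset.card_range]
  have hle2 : ∀ j ∈ (Finset.range H).erase 0, (if r (2 * j) = R₂ then 1 else 0) ≤ 1 :=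
    fun j _ => by split_ifs <;> omega
  have hN2le : ∑ j ∈ (Finset.range H).erase 0, (if r (2 * j) = R₂ then 1 else 0) ≤ H - 1 :=
    (Finset.sum_le_card_nsmul _ _ 1 hle2).trans (by rw [hcardE, smul_eq_mul, mul_one])
  have pN1 : M1 * ∑ t ∈ Finset.range (2 * H), (if r t = R₁ then 1 else 0) = M1 * H := by
    rw [hsplit1, heq1]
  rcases hN2le.lt_or_eq with hlt2 | heq2
  · -- fewer than `H - 1` visits of `R₂`: strictly worse
    left
    have p1 : M2 * ∑ t ∈ Finset.range (2 * H), (if r t = R₂ then 1 else 0) + M2 * 2 ≤ M2 * H := by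
      rw [hsplit2, hsplit2', ← Nat.mul_add]
      exact Nat.mul_le_mul_left M2 (by omega)
    linarith
  /- 5. Rows pinned: `r = rA` on `[0, L)`. -/
  have hH1 : ∑ _j ∈ (Finset.range H).erase 0, (1 : ℕ) = H - 1 := by
    rw [Finset.sum_const, hcardE, smul_eq_mul, mul_one]
  have hall := (Finset.sum_eq_sum_iff_of_le hle2).1 (heq2.trans hH1.symm)
  have hR2 : ∀ j, 1 ≤ j → j < H → r (2 * j) = R₂ := by
    intro j hj1 hj2
    have h := hall j (Finset.mem_erase.2 ⟨by omega, Finset.mem_range.2 hj2⟩)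
    by_contra hne
    rw [if_neg hne] at h
    omega
  have hrows : ∀ t, t < 2 * H → r t = rA t := by
    intro t ht
    obtain ⟨j, rfl | rfl⟩ := Nat.even_or_odd' t
    · rcases Nat.eq_zero_or_pos j with rfl | hj
      · rw [Nat.mul_zero, hr0, hrA0]
      · rw [hR2 j hj (by omega), hrA2 j hj]
    · rw [(hdom j (by omega)).2, hrA1]
  have hRReq : ∑ t ∈ Finset.range (2 * H), u (r t, a₀) = ∑ t ∈ Finset.range (2 * H), u (rA t, a₀) :=
    Finset.sum_congr rfl fun t ht => by rw [hrows t (Finset.mem_range.1 ht)]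
  have hKeq : ∑ t ∈ Finset.range (2 * H), (u (r t, c t) + 2 * u (r t, c (t + 1))) =
      ∑ t ∈ Finset.range (2 * H), (u (rA t, c t) + 2 * u (rA t, c (t + 1))) :=
    Finset.sum_congr rfl fun t ht => by rw [hrows t (Finset.mem_range.1 ht)]
  /- 6. Level 3 and 4: the visits of `C_a` and `C_b` among the positions `1..L`. -/
  have hsplita := magnet_sum_range_two_mul (fun t => if c (t + 1) = Ca then 1 else 0) H
  have hsplitb := magnet_sum_range_two_mul (fun t => if c (t + 1) = Cb then 1 else 0) H
  obtain ⟨hNale, hNaeq⟩ := magnet_pair_count (fun j => c (2 * j + 1)) (fun j => c (2 * j + 1 + 1))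
    Ca H (fun j hj => hcc (2 * j + 1) (by omega))
  obtain ⟨hNble, hNbeq⟩ := magnet_pair_count (fun j => c (2 * j + 1)) (fun j => c (2 * j + 1 + 1))
    Cb H (fun j hj => hcc (2 * j + 1) (by omega))
  rcases hNale.lt_or_eq with hlta | heqa
  · -- fewer than `H` visits of `C_a`: strictly worse
    left
    have q3 : M3 * ∑ t ∈ Finset.range (2 * H), (if c (t + 1) = Ca then 1 else 0) + M3 ≤ M3 * H := by
      rw [hsplita, ← Nat.mul_succ]
      exact Nat.mul_le_mul_left M3 hlta
    have q4 : M4 * ∑ t ∈ Finset.range (2 * H), (if c (t + 1) = Cb then 1 else 0) ≤ M4 * H := by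
      rw [hsplitb]
      exact Nat.mul_le_mul_left M4 hNble
    rw [hRReq]
    linarith
  rcases hNble.lt_or_eq with hltb | heqb
  · -- `H` visits of `C_a` but fewer than `H` of `C_b`: strictly worse
    left
    have q3 : M3 * ∑ t ∈ Finset.range (2 * H), (if c (t + 1) = Ca then 1 else 0) = M3 * H := by
      rw [hsplita, heqa]
    have q4 : M4 * ∑ t ∈ Finset.range (2 * H), (if c (t + 1) = Cb then 1 else 0) + M4 ≤ M4 * H := by
      rw [hsplitb, ← Nat.mul_succ]
      exact Nat.mul_le_mul_left M4 hltb
    rw [hRReq]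
    linarith
  /- 7. Columns alternate between `C_a` and `C_b`; the phase decides. -/
  have hpa := hNaeq heqa
  have hpb := hNbeq heqb
  by_cases hc1 : c 1 = Ca
  · -- phase b (`c 0 = C_b`): same rewards, cost `8H > 7H`: strictly worse
    left
    have hpat := magnet_alt_pattern c Ca Cb hab H hcc hpa hpb hc1
    have hc0 : c 0 = Cb := by
      rw [← hcL]
      have h := (hpat (H - 1) (by omega)).2
      rwa [show 2 * (H - 1) + 1 + 1 = 2 * H by omega] at h
    have hCRb : ∑ t ∈ Finset.range (2 * H), u (ρ₀, c (t + 1)) = H * (M3 + M4) := by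
      rw [magnet_sum_range_two_mul]
      have h1 : ∀ j ∈ Finset.range H,
          u (ρ₀, c (2 * j + 1)) + u (ρ₀, c (2 * j + 1 + 1)) = M3 + M4 := by
        intro j hj
        obtain ⟨hca, hcb⟩ := hpat j (Finset.mem_range.1 hj)
        rw [hca, hcb, hP1, hP2]
      rw [Finset.sum_congr rfl h1, Finset.sum_const, Finset.card_range, smul_eq_mul]
    have hK8 : ∑ t ∈ Finset.range (2 * H), (u (rA t, c t) + 2 * u (rA t, c (t + 1))) = H * 8 := by
      rw [magnet_sum_range_two_mul]
      have h8 : ∀ j ∈ Finset.range H,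
          u (rA (2 * j), c (2 * j)) + 2 * u (rA (2 * j), c (2 * j + 1)) +
            (u (rA (2 * j + 1), c (2 * j + 1)) + 2 * u (rA (2 * j + 1), c (2 * j + 1 + 1))) = 8 := by
        intro j hj
        obtain ⟨hca, hcb⟩ := hpat j (Finset.mem_range.1 hj)
        rw [hca, hcb, hrA1, h1a, h1b]
        rcases Nat.eq_zero_or_pos j with rfl | hjpos
        · rw [Nat.mul_zero, hrA0, hc0, h0b, h0a]
        · rw [hrA2 j hjpos]
          have hj' := Finset.mem_range.1 hj
          have h := (hpat (j - 1) (by omega)).2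
          rw [show 2 * (j - 1) + 1 + 1 = 2 * j by omega] at h
          rw [h, h2b, h2a]
      rw [Finset.sum_congr rfl h8, Finset.sum_const, Finset.card_range, smul_eq_mul]
    rw [hRReq, hKeq, hK8, hKa, hCRb, hCRa]
    linarith
  · -- phase a (`c 0 = C_a`): this IS the bouncing walk
    right
    have hpa0 := hpa 0 (by omega)
    have hpb0 := hpb 0 (by omega)
    have hc1' : c (2 * 0 + 1) ≠ Ca := by simpa using hc1
    rw [if_neg hc1', zero_add] at hpa0
    have hc2 : c (2 * 0 + 1 + 1) = Ca := by
      by_contra h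
      rw [if_neg h] at hpa0
      omega
    rw [if_neg (fun h => hab (hc2.symm.trans h)), add_zero] at hpb0
    have hc1b : c (2 * 0 + 1) = Cb := by
      by_contra h
      rw [if_neg h] at hpb0
      omega
    have hpat := magnet_alt_pattern c Cb Ca hab.symm H hcc hpb hpa (by simpa using hc1b)
    refine ⟨hrows, fun s hs => ?_⟩
    obtain ⟨j, rfl | rfl⟩ := Nat.even_or_odd' s
    · rw [hcA0]
      rcases Nat.eq_zero_or_pos j with rfl | hj
      · rw [Nat.mul_zero, ← hcL]
        have h := (hpat (H - 1) (by omega)).2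
        rwa [show 2 * (H - 1) + 1 + 1 = 2 * H by omega] at h
      · have h := (hpat (j - 1) (by omega)).2
        rwa [show 2 * (j - 1) + 1 + 1 = 2 * j by omega] at h
    · rw [hcA1]
      exact (hpat j (by omega)).1


/-- ∀-form of the pair-grouping identity `magnet_sum_range_two_mul` for ℕ-valued sequences (registered marker
`stub_magnetSumPairs` of the line's skeleton, so that this helper file lands attached to the crux):
`Σ_{t<2H} f t = Σ_{j<H} (f(2j) + f(2j+1))`. [folklore] -/
theorem stub_magnetSumPairs :
    ∀ (f : ℕ → ℕ) (H : ℕ), ∑ t ∈ Finset.range (2 * H), f t = ∑ j ∈ Finset.range H, (f (2 * j) + f (2 * j + 1)) :=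
  fun f H => magnet_sum_range_two_mul f H

end Summit.ValiantsHypothesis.ValiantsHypothesis.Theorems.DivisionGapPerDivisionHard

end
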